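import Literature.Computability.Complexity.SuccinctCircuitBitsEvaluator
import HarnessLib

/-!
# Succinct arithmetic circuits of polynomial depth, VI: a worked instance (iterated squaring)

A TEMPLATE for consumers of parts I–III (`SuccCircuit`, `bitLang_mem_PSPACE`): the family of
variable-free circuits `x_0 = 3`, `x_{t+1} = x_t · x_t` (so `x_t = 3^{2^t}`, a number of `Θ(2^t)`
bits — Knuth's binary method of exponentiation, §4.6.3, run for `t` squarings), written as ONE
`FP`-succinct circuit `powCircuit` and evaluated bit-wise in polynomial space by the generic
theorem. It shows the three idioms every instance needs:

* NAMES carry the instance in unary and a fixed record of fields — here `powName n t = ⟨1ⁿ, bin t⟩`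
  — and a gate is live only if its name is CANONICAL (`g = ⟨1^{|fst g|}, bin (val (snd g))⟩`,
  a polynomial-time test) and in range (`1 ≤ t ≤ n`); every other string is a constant gate. This
  makes `length_child` (children no longer than the parent) and `depth_le` (depth `≤ |name|`)
  one-liners.
* the five syntax functions are assembled from `CodeFP` bricks on the total decoders `fstF`, `sndF`,
  `bitsToNat` (`kind_fp`, `child_fp`, …), never by a hand-written machine;
* the VALUE of the live gates is computed by the unfolding lemmas `val_mul` / `val_const`
  (`val_powName : powCircuit.val (powName n t) = 3 ^ 2 ^ t` for `t ≤ n`), and the bit language is in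
  `PSPACE` by `bitLang_mem_PSPACE` (`powCircuit_bitLang_mem_PSPACE`, `mem_powCircuit_bitLang_iff`).

HONEST FRAMING (val-lit, KV20 M1 programme, brick (P2) layer G): a usage example of generic
plumbing; proves nothing about `kumarVolk2020_cor_1_3`; `VP ≠ VNP` is NOT proved.

## References

* D. E. Knuth, *TAOCP 2*, §4.6.3 (evaluation of powers: the binary method, repeated squaring)
  [KnuthTAOCP2].
* P. Koiran, S. Perifel, *VPSPACE and a transfer theorem over the reals*, Comput. Complexity 18
  (2009), §3.2, Prop. 1 [KoiranPerifel2009VPSPACE].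
-/

noncomputable section

namespace Literature.Computability.Complexity

open _root_.Computability Polynomial CodeFP Brick Finset

namespace SuccCircuit

namespace PowExample

/-- The name of the gate `x_t` of the instance `n`: `⟨1ⁿ, bin t⟩`. [cite: KnuthTAOCP2, §4.6.3] -/
def powName (n t : ℕ) : List Bool := pairE unE natE (n, t)

/-- The instance parameter read off a name (`|fst g|`). [cite: AroraBarak2009, §0.1] -/
def nOf (g : List Bool) : ℕ := (fstF g).length

/-- The field `t` read off a name (`val (snd g)`). [cite: AroraBarak2009, §0.1] -/
def tOf (g : List Bool) : ℕ := bitsToNat (sndF g)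

/-- A name is LIVE if it is canonical (`g = ⟨1^{nOf g}, bin (tOf g)⟩`) and `1 ≤ t ≤ n` (a Boolean,
polynomial-time test); live gates are squarings, all other strings are the constant `3`. [cite: KnuthTAOCP2, §4.6.3] -/
def live (g : List Bool) : Bool :=
  decide (g = powName (nOf g) (tOf g)) && (decide (1 ≤ tOf g) && decide (tOf g ≤ nOf g))

/-- What liveness says. [cite: KnuthTAOCP2, §4.6.3] -/
theorem live_iff (g : List Bool) : live g = true ↔ g = powName (nOf g) (tOf g) ∧ 1 ≤ tOf g ∧ tOf g ≤ nOf g := by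
  simp [live, Bool.and_eq_true, decide_eq_true_eq]

/-- Reading the fields of a canonical name. [cite: AroraBarak2009, §0.1] -/
theorem nOf_powName (n t : ℕ) : nOf (powName n t) = n := by
  simp [nOf, powName, pairE, length_unE]

/-- Reading the fields of a canonical name. [cite: AroraBarak2009, §0.1] -/
theorem tOf_powName (n t : ℕ) : tOf (powName n t) = t := by
  simp [tOf, powName, pairE, natE]

/-- Canonical names in range are live. [cite: KnuthTAOCP2, §4.6.3] -/
theorem live_powName {n t : ℕ} (h1 : 1 ≤ t) (h2 : t ≤ n) : live (powName n t) = true := by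
  rw [live_iff, nOf_powName, tOf_powName]
  exact ⟨rfl, h1, h2⟩

/-- `x_0` is not live (it is the constant). [cite: KnuthTAOCP2, §4.6.3] -/
theorem live_powName_zero (n : ℕ) : live (powName n 0) = false := by
  rw [Bool.eq_false_iff, ne_eq, live_iff, tOf_powName]
  omega

/-- The length of a canonical name. [cite: AroraBarak2009, §0.1] -/
theorem length_powName (n t : ℕ) : (powName n t).length = 2 * n + 2 + (natE t).length := by
  simp [powName, pairE, length_boolPair, length_unE]

/-- A smaller field gives a name no longer. [cite: AroraBarak2009, §0.1] -/
theorem length_powName_pred_le (n t : ℕ) : (powName n (t - 1)).length ≤ (powName n t).length := by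
  rw [length_powName, length_powName]
  have h1 : t < 2 ^ (natE t).length := (length_encodeNat_le_iff t _).1 le_rfl
  have h2 : (natE (t - 1)).length ≤ (natE t).length := (length_encodeNat_le_iff _ _).2 (by omega)
  omega

/-- **The iterated-squaring circuit** `x_0 = 3`, `x_{t+1} = x_t²` as one succinct circuit: live
names are product gates with both children `⟨1ⁿ, bin (t−1)⟩`, everything else is the 2-bit constant
`3`; depth `min t n ≤ |name|`. [cite: KnuthTAOCP2, §4.6.3] [cite: KoiranPerifel2009VPSPACE, §3.2, Prop. 1] -/
def powCircuit : SuccCircuit where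
  kind := fun g => if live g then 2 else 0
  width := fun _ => 2
  cbit := fun _ i => decide (i < 2)
  arity := fun _ => 0
  child := fun g _ => powName (nOf g) (tOf g - 1)
  depth := fun g => min (tOf g) (nOf g)
  dpoly := X
  kind_fp := by
    have hfst : CodeFP strE strE fstF := of_fn fstF fstF_mem_FP fun _ => rfl
    have hsnd : CodeFP strE strE sndF := of_fn sndF sndF_mem_FP fun _ => rfl
    have hn : CodeFP strE unE nOf := (strLength.comp hfst).congr fun _ => rfl
    have ht : CodeFP strE natE tOf := (strVal.comp hsnd).congr fun _ => rfl
    have harg : CodeFP strE strE (fun g => powName (nOf g) (tOf g)) :=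
      (hn.pair ht).recodeOut (eγ := strE) fun _ => rfl
    have hcanon : CodeFP strE bitE (fun g => decide (g = powName (nOf g) (tOf g))) :=
      (CodeFP.eq (eα := strE) fun _ _ h => h).comp ((CodeFP.id strE).pair harg)
    have h1 : CodeFP strE bitE (fun g => decide (1 ≤ tOf g)) := natLe.comp ((const strE (1 : ℕ)).pair ht)
    have h2 : CodeFP strE bitE (fun g => decide (tOf g ≤ nOf g)) := natLeUn.comp (ht.pair hn)
    exact ((hcanon.and (h1.and h2)).ite (const strE (2 : ℕ)) (const strE (0 : ℕ))).congr fun g => rfl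
  width_fp := const strE (2 : ℕ)
  cbit_fp := (natLt.comp ((snd strE natE).pair (const _ (2 : ℕ)))).congr fun _ => rfl
  arity_fp := const strE (0 : ℕ)
  child_fp := by
    have hfst : CodeFP strE strE fstF := of_fn fstF fstF_mem_FP fun _ => rfl
    have hsnd : CodeFP strE strE sndF := of_fn sndF sndF_mem_FP fun _ => rfl
    have hn : CodeFP (pairE strE natE) unE (fun p => nOf p.1) := ((strLength.comp hfst).comp (fst _ _)).congr fun _ => rfl
    have ht : CodeFP (pairE strE natE) natE (fun p => tOf p.1 - 1) :=
      (natSub.comp (((strVal.comp hsnd).comp (fst _ _)).pair (const _ (1 : ℕ)))).congr fun _ => rfl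
    exact (hn.pair ht).recodeOut (eγ := strE) fun _ => rfl
  depth_child := by
    intro g k hk
    by_cases h : live g = true
    · obtain ⟨-, h1, h2⟩ := (live_iff g).1 h
      simp only [tOf_powName, nOf_powName]
      omega
    · simp [gateFanIn, h] at hk
  length_child := by
    intro g k hk
    by_cases h : live g = true
    · obtain ⟨hg, -, -⟩ := (live_iff g).1 h
      conv_rhs => rw [hg]
      exact length_powName_pred_le _ _
    · simp [gateFanIn, h] at hk
  depth_le := fun g => by
    rw [eval_X]
    have := length_boolUnpair_parts_le g
    change min (tOf g) (boolUnpair g).1.length ≤ _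
    omega

/-- The constant gates hold `3`. [cite: KnuthTAOCP2, §4.6.3] -/
theorem cval_powCircuit (g : List Bool) : powCircuit.cval g = 3 := by
  simp [SuccCircuit.cval, powCircuit, sum_range_succ]

/-- **The value of the gate `⟨1ⁿ, bin t⟩` is `3^{2^t}`** (`t ≤ n`). [cite: KnuthTAOCP2, §4.6.3 (binary method: t squarings)] -/
theorem val_powName {n : ℕ} : ∀ {t : ℕ}, t ≤ n → powCircuit.val (powName n t) = 3 ^ 2 ^ t
  | 0, _ => by
    have hk : powCircuit.kind (powName n 0) = 0 := by
      simp [powCircuit, live_powName_zero]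
    rw [powCircuit.val_const (by rw [hk]; norm_num) (by rw [hk]; norm_num) (by rw [hk]; norm_num), cval_powCircuit]
    norm_num
  | t + 1, h => by
    have hk : powCircuit.kind (powName n (t + 1)) = 2 := by
      simp [powCircuit, live_powName (show 1 ≤ t + 1 by omega) h]
    rw [powCircuit.val_mul hk]
    change powCircuit.val (powName (nOf (powName n (t + 1))) (tOf (powName n (t + 1)) - 1)) *
      powCircuit.val (powName (nOf (powName n (t + 1))) (tOf (powName n (t + 1)) - 1)) = _
    rw [nOf_powName, tOf_powName, Nat.add_sub_cancel, val_powName (by omega)]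
    rw [pow_succ, pow_mul, sq]

/-- **The bits of `3^{2^t}` are decided in polynomial space** (in `|⟨⟨1ⁿ, bin t⟩, bin i⟩|`), as an
instance of `bitLang_mem_PSPACE`. [cite: KoiranPerifel2009VPSPACE, §3.2, Prop. 1] -/
theorem powCircuit_bitLang_mem_PSPACE : powCircuit.bitLang ∈ PSPACE := powCircuit.bitLang_mem_PSPACE

/-- The queries of the example: `⟨⟨1ⁿ, bin t⟩, bin i⟩ ∈ bitLang ↔` bit `i` of `3^{2^t}` (`t ≤ n`). [cite: KoiranPerifel2009VPSPACE, §3.1, Def. 1] -/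
theorem mem_powCircuit_bitLang_iff {n t : ℕ} (h : t ≤ n) (i : ℕ) :
    boolPair (powName n t) (natE i) ∈ powCircuit.bitLang ↔ (3 ^ 2 ^ t).testBit i = true := by
  rw [powCircuit.mem_bitLang_iff, val_powName h]

end PowExample

end SuccCircuit

end Literature.Computability.Complexity
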